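import Summits.HodgeConjecture.CorCM.MultiFieldWeilUnitsMenuShapes
import HarnessLib

/-!
# MULTI-FIELD WEIL ENGINE — SHOWCASE: THREE SIMPLE CM FOURFOLDS OVER ONE `𝔄₄`/`𝔖₄`-OCTIC FIELD BY SHAPE — `E` and three pairwise non-isogenous simple CM fourfolds over one
# octic CM field `K ∋ k` with a degree-`24` pair, every `(2,2)`-type separating every two `(1,3)`-types: the Hodge conjecture for every product of copies, given only Markman's
# fourfold and hyperbolic-sixfold theorems

Cell `pub-hodgecm2` (COR-CM), seat b30 gen 40 (2026-08-26); count-neutral own lane MULTI-FIELD WEIL ENGINE (stem `MultiFieldWeil*`), the ONE-FIELD octic instance of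
`CorCM/MultiFieldWeilUnitsMenuShapes.lean` (G3, `hodgeConjectureFor_biproduct_sigma_of_shapes`) written out with the hypotheses a reader needs and nothing else (no second field:
`Hom = ∅`, octic → sextic, degree `40` all disappear).  Theorems only; no definition, no named fact, no `sorry`.  HONEST FRAMING: conditional ONLY on the two displayed Markman
binders; `HC_CM` is NOT proved and not asserted.

**`hodgeConjectureFor_biproduct_octicTriple_of_shapes`.**  `k` imaginary quadratic with `τ`, `E ⊨ (k; {τ})`; `K ⊇ iK(k)` an octic CM field with two `τ`-embeddings `s₀ ≠ t₀`
generating with `τ(k)` a field of degree `24` (quartic part `𝔄₄` or `𝔖₄`); three structures `B t ⊨ (K; Ψ t)` (`t : Fin 3`) with `1` or `2` members of `Ψ t` over `τ` (types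
normalised: `k`-signature `(1,3)` or `(2,2)`), pairwise NON-ISOGENOUS, and SEPARATION: whenever `Ψ t₁`, `Ψ t₂` (`t₁ ≠ t₂`) have one member over `τ` and `Ψ t₃` has two, `Ψ t₃`
contains the `τ`-member of exactly one of `Ψ t₁`, `Ψ t₂`.  THEN the Hodge conjecture holds for every product of copies `⨁_l X_l`, `X_l ∈ {E, B 0, B 1, B 2}`, GIVEN ONLY
Markman's two theorems.  This covers EVERY independent octic triple (three `(2,2)`-classes; two `(2,2)` + one `(1,3)`; one `(2,2)` separating two `(1,3)`; three `(1,3)` —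
gen 39's U4 needed «a `(2,2)`-slot has a `(2,2)`-partner»); the excluded triple `B_q, B_{q'}, B_{{q,q'}^{±}}` is dependent (U5a) and outside the method (G8).
[cite: Markman2025SurveySecant, Thm. 1.2] [cite: Markman2025SecantWeil, Thm 1.5.1] [cite: Shimura1998, §6.1 Corollary of Theorem 2, §8.2 Prop. 26, §18.2 Lemma (i)]
[cite: Deligne1982HodgeCycles, §5 (b)] [cite: DixonMortimer1996, §1.4 Ex. 1.4.1–1.4.2; §1.6, Thm. 1.6A; §2.1] [cite: Lang2002, XIII §4; XV §1] [cite: MumfordAV1970, §19]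

## References
* [Markman2025SurveySecant] E. Markman, arXiv:2509.23403, Thm. 1.2.  [Markman2025SecantWeil] E. Markman, Cycles on abelian 2n-folds of Weil type from secant sheaves on abelian
  n-folds, Thm 1.5.1.  [Shimura1998] G. Shimura, *Abelian varieties with complex multiplication and modular functions*, §6.1, §8.2, §18.2.  [Deligne1982HodgeCycles]
  P. Deligne, LNM 900, §5 (b).  [DixonMortimer1996] J. D. Dixon, B. Mortimer, *Permutation Groups*, GTM 163.  [Lang2002] S. Lang, *Algebra*, GTM 211, XIII §4, XV §1.
  [MumfordAV1970] D. Mumford, *Abelian Varieties*, §19.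
-/

noncomputable section

open CategoryTheory CategoryTheory.Limits NumberField IntermediateField

namespace Summit.HodgeConjecture.CorCM.MultiFieldWeil

open Finset
open Literature.AlgebraicGeometry Literature.AlgebraicGeometry.Motives Literature.AlgebraicGeometry.HodgeTheory
open Literature.AlgebraicGeometry.ComplexMultiplication (IsCMTypeRealisation)
open Literature.AlgebraicTopology.SingularHomology
open Literature.NumberTheory.ComplexMultiplication

open scoped Classical

section OcticTriple

variable {K : Type} [fK : Field K] [nK : NumberField K] [cK : IsCMField K] {k : Type} [fk : Field k] [nk : NumberField k] [ck : IsCMField k] {τ : k →+* ℂ}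
  {B : Fin 3 → AbelianVariety ℂ} {Ψ : Fin 3 → CMType K} {ιB : ∀ t : Fin 3, 𝓞 K →+* End (B t)} {θB : ∀ t : Fin 3, K →+* Module.End ℂ (complexBetti (B t).X 1)}
  {E : AbelianVariety ℂ} {Φ₀ : CMType k} {ιE : 𝓞 k →+* End E} {θE : k →+* Module.End ℂ (complexBetti E.X 1)}

/-- **THREE SIMPLE CM FOURFOLDS OVER ONE `𝔄₄`/`𝔖₄`-OCTIC FIELD BY SHAPE, WITH `E` — GIVEN ONLY MARKMAN'S FOURFOLD AND HYPERBOLIC-SIXFOLD THEOREMS.**  See the module docstring.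
`HC_CM` is NOT asserted. [cite: Markman2025SurveySecant, Thm. 1.2] [cite: Markman2025SecantWeil, Thm 1.5.1] [cite: Shimura1998, §6.1 Corollary of Theorem 2, §8.2 Prop. 26, §18.2]
[cite: Deligne1982HodgeCycles, §5 (b)] [cite: DixonMortimer1996, §1.6, Thm. 1.6A; §2.1] [cite: Lang2002, XIII §4; XV §1] -/
theorem hodgeConjectureFor_biproduct_octicTriple_of_shapes (hW4 : Markman2025_weilClasses_algebraic_abelianFourfold)
    (hM6 : Markman2025_weilClasses_algebraic_hyperbolicSixfold) (h2 : Module.finrank ℚ k = 2) (iK : k →+* K) (h8 : Module.finrank ℚ K = 8)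
    (hB : ∀ t, IsCMTypeRealisation (Ψ t) (B t) (ιB t) (θB t)) (hE : IsCMTypeRealisation Φ₀ E ιE θE) (hΦ₀ : ∀ σ : k →+* ℂ, σ ∈ Φ₀.1 ↔ σ = τ)
    (hcnt : ∀ t, (Finset.univ.filter fun s : K →+* ℂ => s.comp iK = τ ∧ s ∈ (Ψ t).1).card = 1 ∨ (Finset.univ.filter fun s : K →+* ℂ => s.comp iK = τ ∧ s ∈ (Ψ t).1).card = 2)
    (hni : ∀ t t', t ≠ t' → ¬ AbelianVariety.IsIsogenous (B t) (B t'))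
    (hsep : ∀ t₁ t₂ t₃ : Fin 3, t₁ ≠ t₂ → (Finset.univ.filter fun u : K →+* ℂ => u.comp iK = τ ∧ u ∈ (Ψ t₁).1).card = 1 →
      (Finset.univ.filter fun u : K →+* ℂ => u.comp iK = τ ∧ u ∈ (Ψ t₂).1).card = 1 → (Finset.univ.filter fun u : K →+* ℂ => u.comp iK = τ ∧ u ∈ (Ψ t₃).1).card = 2 →
      ∀ s₁ s₂ : K →+* ℂ, s₁.comp iK = τ → s₂.comp iK = τ → s₁ ∈ (Ψ t₁).1 → s₂ ∈ (Ψ t₂).1 → (s₁ ∈ (Ψ t₃).1 ↔ s₂ ∉ (Ψ t₃).1))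
    (h24 : ∃ s₀ t₀ : K →+* ℂ, s₀.comp iK = τ ∧ t₀.comp iK = τ ∧ s₀ ≠ t₀ ∧ Module.finrank ℚ ↥(adjoin ℚ (Set.range τ) ⊔ adjoin ℚ (Set.range s₀ ∪ Set.range t₀)) = 24)
    {N : ℕ} (κ : Fin N → Option (Fin 3)) :
    HodgeConjectureFor (⨁ fun l => ((κ l).elim E B : AbelianVariety ℂ)).dim (⨁ fun l => ((κ l).elim E B : AbelianVariety ℂ)).X := by
  -- the grouped menu with one field
  have key := hodgeConjectureFor_biproduct_sigma_of_shapes (J := PUnit) (KJ := fun _ => K) (c := fun _ => 3) (B := fun _ t => B t) (Ψ := fun _ t => Ψ t)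
    (ιB := fun _ t => ιB t) (θB := fun _ t => θB t) hW4 hM6 h2 (fun _ => iK) (fun _ => 4) (fun _ => by rw [h8]) (fun _ t => hB t) hE hΦ₀
    (fun _ h => absurd h (by norm_num))
    (fun _ t => by
      rcases hcnt t with h | h
      · exact Or.inr (Or.inl ⟨rfl, h⟩)
      · exact Or.inr (Or.inr (Or.inl ⟨rfl, h⟩)))
    (fun _ t t' htt => hni t t' htt) (fun _ h => absurd h (by norm_num)) (fun _ _ => le_rfl) (fun _ h => absurd h (by norm_num)) (fun _ _ => hsep)
    (fun _ h => absurd h (by norm_num)) (fun _ h => absurd h (by norm_num)) (fun _ _ => h24) (fun _ h => absurd h (by norm_num))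
    (fun j j' hne => absurd (Subsingleton.elim j' j) hne) (fun _ _ _ h => absurd h (by norm_num)) (fun l => (κ l).map fun t => (⟨PUnit.unit, t⟩ : (_ : PUnit) × Fin 3))
  have hfam : (fun l => (((κ l).map fun t => (⟨PUnit.unit, t⟩ : (_ : PUnit) × Fin 3)).elim E fun x => B x.2 : AbelianVariety ℂ)) = fun l => ((κ l).elim E B : AbelianVariety ℂ) := by
    funext l
    rcases κ l with _ | t <;> rfl
  rw [hfam] at key
  exact key

/-- **Dominated form**: every abelian variety dominated by such a product. [cite: Markman2025SurveySecant, Thm. 1.2] [cite: Markman2025SecantWeil, Thm 1.5.1] [cite: MumfordAV1970, §19] -/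
theorem hodgeConjectureFor_of_avDominatedBy_octicTriple_of_shapes (hW4 : Markman2025_weilClasses_algebraic_abelianFourfold)
    (hM6 : Markman2025_weilClasses_algebraic_hyperbolicSixfold) (h2 : Module.finrank ℚ k = 2) (iK : k →+* K) (h8 : Module.finrank ℚ K = 8)
    (hB : ∀ t, IsCMTypeRealisation (Ψ t) (B t) (ιB t) (θB t)) (hE : IsCMTypeRealisation Φ₀ E ιE θE) (hΦ₀ : ∀ σ : k →+* ℂ, σ ∈ Φ₀.1 ↔ σ = τ)
    (hcnt : ∀ t, (Finset.univ.filter fun s : K →+* ℂ => s.comp iK = τ ∧ s ∈ (Ψ t).1).card = 1 ∨ (Finset.univ.filter fun s : K →+* ℂ => s.comp iK = τ ∧ s ∈ (Ψ t).1).card = 2)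
    (hni : ∀ t t', t ≠ t' → ¬ AbelianVariety.IsIsogenous (B t) (B t'))
    (hsep : ∀ t₁ t₂ t₃ : Fin 3, t₁ ≠ t₂ → (Finset.univ.filter fun u : K →+* ℂ => u.comp iK = τ ∧ u ∈ (Ψ t₁).1).card = 1 →
      (Finset.univ.filter fun u : K →+* ℂ => u.comp iK = τ ∧ u ∈ (Ψ t₂).1).card = 1 → (Finset.univ.filter fun u : K →+* ℂ => u.comp iK = τ ∧ u ∈ (Ψ t₃).1).card = 2 →
      ∀ s₁ s₂ : K →+* ℂ, s₁.comp iK = τ → s₂.comp iK = τ → s₁ ∈ (Ψ t₁).1 → s₂ ∈ (Ψ t₂).1 → (s₁ ∈ (Ψ t₃).1 ↔ s₂ ∉ (Ψ t₃).1))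
    (h24 : ∃ s₀ t₀ : K →+* ℂ, s₀.comp iK = τ ∧ t₀.comp iK = τ ∧ s₀ ≠ t₀ ∧ Module.finrank ℚ ↥(adjoin ℚ (Set.range τ) ⊔ adjoin ℚ (Set.range s₀ ∪ Set.range t₀)) = 24)
    {N : ℕ} (κ : Fin N → Option (Fin 3)) {X : AbelianVariety ℂ} (hX : Domination.AVDominatedBy X (⨁ fun l => ((κ l).elim E B : AbelianVariety ℂ))) :
    HodgeConjectureFor X.dim X.X :=
  Domination.hodgeConjectureFor_of_avDominatedBy (hodgeConjectureFor_biproduct_octicTriple_of_shapes hW4 hM6 h2 iK h8 hB hE hΦ₀ hcnt hni hsep h24 κ) hX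

end OcticTriple

end Summit.HodgeConjecture.CorCM.MultiFieldWeil

end
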